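import Summits.BirchSwinnertonDyer.BirchSwinnertonDyer.Theorems.ByReductionTypeAtTwoOrdKatoHalfAtTwoIsoGreenbergMuNegDefs
import Literature.NumberTheory.EllipticCurves.Kato2004.IwasawaCohomologyUniqueProofs
import HarnessLib

/-!
# Cert53c — crux-triage r1-2 GEN 53 ADDENDUM (independent seat 2/2), crux `ByReductionTypeAtTwo.OrdKatoHalfAtTwoIso`
# (item stmt-BirchSwinnertonDyer-19573), line `steinberg-fibre-at-two`, skeleton of record v24 `4921f2ec…`.

Refuter step 6 (ii) «junk model of the interface» run against the CANDIDATE stub MU13⁻ = `ZetaQuotientMuZeroTwoOrdNegDisc`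
(p735706; option (b) of w3 GEN 7 would REGISTER it in a v25): its datum binder `∀ I : IwasawaH1Data W 2 κ γ` ranges over a
hypothesis STRUCTURE with its own carrier `I.H : Type` — prima facie a junk door (an exotic carrier making the stub false or
true for the wrong reason). CLOSED by the tree: the pin (`proj` bijective onto the norm-compatible integral families, `T`/`C`
actions levelwise) is PROVED unique up to a `proj`-compatible `Λ`-isomorphism (`IwasawaH1Data.exists_linearEquiv`,
`IwasawaCohomologyUniqueProofs` :117, sorry-free) and inhabited (`nonempty_iwasawaH1Data_holds`), and BOTH conjuncts of MU13⁻'s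
cell predicate transport along such an isomorphism (`IsEulerSystemClassTwo` reads only `I.proj`; the quotient `I.H ⧸ Λz` moves
by `Submodule.Quotient.equiv`). Hence `(∀ I, P I) ↔ (∃ I, P I)` and MU13⁻ ⟺ its `∃ I` form: the `I`-slot is INERT — no junk
refutation and no junk proof through `I`; the Δ < 0 / `𝐇¹`-side twin of Cert53a (the `D`-slot of G11±).
Certifies implications between displayed statements; asserts nothing; MU13⁻ is OPEN (memo tier); BSD is NOT proved.
-/

set_option autoImplicit false
set_option linter.dupNamespace false

noncomputable section

open scoped Classical
open WeierstrassCurve Field IsDedekindDomain NumberField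
open Literature.NumberTheory.GaloisRepresentations
open Literature.NumberTheory.EllipticCurves Literature.NumberTheory.EllipticCurves.Kato2004
  Literature.NumberTheory.EllipticCurves.Kato2004.EulerSystemValues
open Literature.NumberTheory.EllipticCurves.Rank1Residual
open Summit.BirchSwinnertonDyer.BirchSwinnertonDyer.Theorems.SteinbergFibreAtTwo

namespace Summit.BirchSwinnertonDyer.BirchSwinnertonDyer.Cruxes.OrdKatoHalfAtTwoIso.Cert53c

section Transport

variable {W : WeierstrassCurve ℚ} [W.IsElliptic] [ContinuousSMul ℤ_[2] (W.tateModule 2)]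
  [Module.Free ℤ_[2] (W.tateModule 2)] [Module.Finite ℤ_[2] (W.tateModule 2)]
  {κ : ZpExtension ℚ 2} (hκ : κ.IsCyclotomic) {γ : absoluteGaloisGroup ℚ}

/-- `IsEulerSystemClassTwo` reads the datum only through `I.proj`, so it moves along any `proj`-compatible map. [folklore] -/
theorem isEulerSystemClassTwo_transport (I J : IwasawaH1Data W 2 κ γ) (e : I.H → J.H)
    (he : ∀ (n : ℕ) (x : I.H), J.proj n (e x) = I.proj n x) {s : I.H}
    (hs : IsEulerSystemClassTwo W hκ I s) : IsEulerSystemClassTwo W hκ J (e s) := by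
  obtain ⟨S, hS, z, hz, hint, hproj⟩ := hs
  exact ⟨S, hS, z, hz, hint, fun n => by rw [he, hproj]⟩

omit [Module.Free ℤ_[2] (W.tateModule 2)] [Module.Finite ℤ_[2] (W.tateModule 2)] in
/-- `μ(I.H ⧸ Λz) = 0` (as `ℤ₂`-finiteness of the quotient) moves along a `Λ`-linear isomorphism. [folklore] -/
theorem moduleFinite_quot_transport (I J : IwasawaH1Data W 2 κ γ) (e : I.H ≃ₗ[IwasawaAlgebra 2] J.H) (s : I.H)
    (h : Module.Finite ℤ_[2]
      (RestrictScalars ℤ_[2] (IwasawaAlgebra 2) (I.H ⧸ (IwasawaAlgebra 2) ∙ s))) :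
    Module.Finite ℤ_[2]
      (RestrictScalars ℤ_[2] (IwasawaAlgebra 2) (J.H ⧸ (IwasawaAlgebra 2) ∙ e s)) := by
  have hmap : Submodule.map (e : I.H →ₗ[IwasawaAlgebra 2] J.H) ((IwasawaAlgebra 2) ∙ s) =
      (IwasawaAlgebra 2) ∙ e s := by
    rw [Submodule.map_span, Set.image_singleton]; rfl
  let f : (I.H ⧸ (IwasawaAlgebra 2) ∙ s) ≃ₗ[IwasawaAlgebra 2] (J.H ⧸ (IwasawaAlgebra 2) ∙ e s) :=
    Submodule.Quotient.equiv _ _ e hmap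
  let g' : RestrictScalars ℤ_[2] (IwasawaAlgebra 2) (I.H ⧸ (IwasawaAlgebra 2) ∙ s) ≃ₗ[ℤ_[2]]
      RestrictScalars ℤ_[2] (IwasawaAlgebra 2) (J.H ⧸ (IwasawaAlgebra 2) ∙ e s) :=
    { toFun := fun x =>
        (RestrictScalars.addEquiv ℤ_[2] (IwasawaAlgebra 2) (J.H ⧸ (IwasawaAlgebra 2) ∙ e s)).symm
          (f (RestrictScalars.addEquiv ℤ_[2] (IwasawaAlgebra 2) (I.H ⧸ (IwasawaAlgebra 2) ∙ s) x))
      invFun := fun y =>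
        (RestrictScalars.addEquiv ℤ_[2] (IwasawaAlgebra 2) (I.H ⧸ (IwasawaAlgebra 2) ∙ s)).symm
          (f.symm (RestrictScalars.addEquiv ℤ_[2] (IwasawaAlgebra 2) (J.H ⧸ (IwasawaAlgebra 2) ∙ e s) y))
      map_add' := fun x y => by simp only [map_add]
      map_smul' := fun c x => by
        simp only [RestrictScalars.addEquiv_map_smul, map_smul,
          RestrictScalars.addEquiv_symm_map_algebraMap_smul, RingHom.id_apply]
      left_inv := fun x => by simp
      right_inv := fun y => by simp }
  exact Module.Finite.equiv g'

/-- **Transport of MU13⁻'s cell predicate between any two pinned carriers** (uniqueness of the pin, PROVED in the tree). [folklore] -/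
theorem muQuotZero_transport (hγ : κ.IsTopGenerator γ) (I J : IwasawaH1Data W 2 κ γ)
    (h : ∃ z : I.H, IsEulerSystemClassTwo W hκ I z ∧
      Module.Finite ℤ_[2] (RestrictScalars ℤ_[2] (IwasawaAlgebra 2) (I.H ⧸ (IwasawaAlgebra 2) ∙ z))) :
    ∃ z : J.H, IsEulerSystemClassTwo W hκ J z ∧
      Module.Finite ℤ_[2] (RestrictScalars ℤ_[2] (IwasawaAlgebra 2) (J.H ⧸ (IwasawaAlgebra 2) ∙ z)) := by
  obtain ⟨e, he⟩ := I.exists_linearEquiv J hγ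
  obtain ⟨z, hz, hfin⟩ := h
  exact ⟨e z, isEulerSystemClassTwo_transport hκ I J e he hz, moduleFinite_quot_transport I J e z hfin⟩

/-- **The `I`-slot of MU13⁻ is INERT:** at every `(W, κ, γ)` with `κ` cyclotomic and `γ` a topological generator,
`(∀ I, P I) ↔ (∃ I, P I)` for MU13⁻'s cell predicate `P` (existence `nonempty_iwasawaH1Data_holds` + transport). [folklore] -/
theorem forall_iff_exists (hγ : κ.IsTopGenerator γ) :
    (∀ I : IwasawaH1Data W 2 κ γ, ∃ z : I.H, IsEulerSystemClassTwo W hκ I z ∧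
      Module.Finite ℤ_[2] (RestrictScalars ℤ_[2] (IwasawaAlgebra 2) (I.H ⧸ (IwasawaAlgebra 2) ∙ z))) ↔
    (∃ I : IwasawaH1Data W 2 κ γ, ∃ z : I.H, IsEulerSystemClassTwo W hκ I z ∧
      Module.Finite ℤ_[2] (RestrictScalars ℤ_[2] (IwasawaAlgebra 2) (I.H ⧸ (IwasawaAlgebra 2) ∙ z))) := by
  constructor
  · intro h
    obtain ⟨I⟩ := nonempty_iwasawaH1Data_holds W 2 κ γ hκ hγ
    exact ⟨I, h I⟩
  · rintro ⟨I, hI⟩ J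
    exact muQuotZero_transport hκ hγ I J hI

/-- Consequently a FAILURE of the cell predicate at one carrier is a failure at every carrier. [folklore] -/
theorem forall_not_of_exists_not (hγ : κ.IsTopGenerator γ)
    (h : ∃ I : IwasawaH1Data W 2 κ γ, ¬ ∃ z : I.H, IsEulerSystemClassTwo W hκ I z ∧
      Module.Finite ℤ_[2] (RestrictScalars ℤ_[2] (IwasawaAlgebra 2) (I.H ⧸ (IwasawaAlgebra 2) ∙ z))) :
    ∀ I : IwasawaH1Data W 2 κ γ, ¬ ∃ z : I.H, IsEulerSystemClassTwo W hκ I z ∧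
      Module.Finite ℤ_[2] (RestrictScalars ℤ_[2] (IwasawaAlgebra 2) (I.H ⧸ (IwasawaAlgebra 2) ∙ z)) := by
  obtain ⟨I, hI⟩ := h
  exact fun J hJ => hI (muQuotZero_transport hκ hγ J I hJ)

end Transport

/-- MU13⁻ with its datum binder weakened to `∃ I` (display only, for the comparison). [folklore] -/
def ZetaQuotientMuZeroTwoOrdNegDiscExists : Prop :=
  ∀ (W : WeierstrassCurve ℚ) [W.IsElliptic] [W.IsGloballyMinimal]
      [ContinuousSMul ℤ_[2] (W.tateModule 2)] [Module.Free ℤ_[2] (W.tateModule 2)] [Module.Finite ℤ_[2] (W.tateModule 2)]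
      (κ : ZpExtension ℚ 2) (γ : absoluteGaloisGroup ℚ) (hκ : κ.IsCyclotomic),
      κ.IsTopGenerator γ → W.Δ < 0 → IsOrdinaryAt W 2 → W.HasSurjectiveModNGaloisRep 2 → IsCyclotomicVariable 2 γ →
      ∃ I : IwasawaH1Data W 2 κ γ,
        ∃ z : I.H, IsEulerSystemClassTwo W hκ I z ∧
          Module.Finite ℤ_[2] (RestrictScalars ℤ_[2] (IwasawaAlgebra 2) (I.H ⧸ (IwasawaAlgebra 2) ∙ z))

/-- **MU13⁻ ⟺ its `∃ I` form** (the registered-candidate text by name on the left). [folklore] -/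
theorem mu13neg_iff_exists : ZetaQuotientMuZeroTwoOrdNegDisc ↔ ZetaQuotientMuZeroTwoOrdNegDiscExists := by
  constructor
  · intro h W _ _ _ _ _ κ γ hκ hγ hΔ hord hsurj hvar
    exact (forall_iff_exists hκ hγ).1 (h W κ γ hκ hγ hΔ hord hsurj hvar)
  · intro h W _ _ _ _ _ κ γ hκ hγ hΔ hord hsurj hvar
    exact (forall_iff_exists hκ hγ).2 (h W κ γ hκ hγ hΔ hord hsurj hvar)

end Summit.BirchSwinnertonDyer.BirchSwinnertonDyer.Cruxes.OrdKatoHalfAtTwoIso.Cert53c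

end
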